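import Literature.NumberTheory.Automorphic.AutomorphicRepsGLCuspidalUnitary
import Literature.NumberTheory.Automorphic.CuspFormsBoundedHC
import Literature.NumberTheory.Automorphic.LanglandsTetrahedralProofs
import HarnessLib

/-!
# Unramified components of `A_G`-invariant cuspidal Borel–Jacquet data are unitary:
# `{ā⁻¹ : a ∈ t_{π,v}} = t_{π,v}` through the Petersson pairing (proofs)

Topic `NumberTheory/Automorphic`; proofs file (theorems only: no definition, no named fact) on
the carriers of `AutomorphicRepsGL` (`CuspidalAutomorphicRepData n K hcpt`,
`AutomorphicRepData.HasSatakeParamAt`). For a closed irreducible `Π ⊂ L²_cusp` the unitarity of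
the right regular representation gives `e_i(α) = e_n(α) \overline{e_{n-i}(α)}` and
`{ā⁻¹ : a ∈ α} = α` for its Satake parameters (`HasSatakeParameterAt.esymm_eq_mul_conj_esymm`,
`HasSatakeParameterAt.map_conj_inv_eq` of `LanglandsTetrahedralProofs`; Deitmar–Echterhoff 2014,
Thm. 11.2.4; Arthur–Clozel 1989, Ch. 3, p. 172: `t̃_v`, the Hecke matrix of the contragredient,
is `\bar t_v`). For a Borel–Jacquet datum `π = W / W'` the tree so far reaches this only through
the two unproved dictionary facts `exists_isAssociatedL2` and `hasSatakeParamAt_iff_L2`. This file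
proves it DIRECTLY for the data on which the Petersson pairing lives — `π` cuspidal, realised on
a subspace (`W' = ⊥`) and with `A_G`-invariant forms — using, instead of `L²`, the invariant
positive-definite Hermitian form `⟪φ, ψ⟫_μ = ∫ φ̃ \bar ψ̃ dμ` of `AutomorphicRepsGLCuspidalUnitary`
(`AdelicGroupData.l2Pairing`: invariant under right translation, `l2Pairing_rightTranslation`;
positive definite on bounded continuous invariant functions, `eq_zero_of_l2Pairing_self_eq_zero`),
which is defined on `W` because `A_G`-invariant cusp forms are bounded (the theorem
`AutomorphicRepsGL.cuspidal_bounded_holds` of `CuspFormsBoundedHC`, `le_bddInvariant_of_cuspidal_bounded`)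
and the automorphic measure exists (`AdelicGroupData.exists_isAutomorphicMeasure_gl_holds`).

## Contents

1. Hecke operators and invariant Hermitian forms (any group `G`, any representation `σ` on a
   complex vector space `V`, any form `B` which on a `σ`-stable subspace `S` is additive,
   homogeneous, Hermitian and `σ`-invariant — the Petersson pairing is all of these on
   `bddInvariant`, but is not a Mathlib inner product space structure):
   `pairing_sum_left`, `pairing_heckeOperator_apply_left` (`B([KgK] u, w) = #(KgK/K) B(σ(g) u, w)`
   for `K`-fixed `u, w ∈ S`; Shimura, Prop. 3.1), `heckeEigenvalue_eq_mul_conj_of_invariantForm`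
   (the adjoint relation `a = c b̄` between the eigenvalues of `[KxK]`, `[KyK]`, `σ(z)` when
   `x⁻¹ = z⁻¹ (w y w⁻¹)`, `w ∈ K`, and the double cosets have the same degree — verbatim
   `heckeEigenvalue_eq_mul_conj` of `LanglandsTetrahedralProofs` with `⟪·, ·⟫` replaced by `B`;
   Deitmar–Echterhoff 2014, proof of Thm. 11.2.4 (b)), `norm_eq_one_of_invariantForm` (an
   eigenvalue of `σ(z)` on `f ∈ S` with `B(f, f) ≠ 0` has absolute value `1`).
2. `CuspidalAutomorphicRepData.esymm_eq_mul_conj_esymm_of_clean` — for `π` cuspidal with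
   `W' = ⊥` and `A_G`-invariant forms and `π.HasSatakeParamAt v α`:
   `e_i(α) = e_n(α) \overline{e_{n-i}(α)}` (`i ≤ n`) and `|e_n(α)| = 1`. The `K(𝔫)`-fixed
   eigenform `φ ∈ W` is a genuine eigenvector (`W' = ⊥`); its eigen-equations are read on
   `GL_n(K_v) ↪ GL_n(𝔸_K)` at the spherical level (`heckeOperator_sphericalLevelAt_eq_principalCongruenceLevel`,
   `heckeOperator_map_apply_eq`, `heckeDiagAt_eq_ofLocal`), `t_{v,n}` is central and acts by
   `e_n(α)` (`heckeOperator_apply_of_mem_center`), `t_i⁻¹ = t_n⁻¹ (w t_{n-i} w⁻¹)` with `w` a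
   permutation matrix in `GL_n(𝒪_v)` and `#(K₀ t_i K₀/K₀) = #(K₀ t_{n-i} K₀/K₀)`
   (`exists_perm_conj_heckeDiag`, `ncard_orbit_eq_of_inv_eq`), and item 1 applies with
   `S = bddInvariant ⊇ W`, `B = ⟪·, ·⟫_μ`.
3. Consequences: `map_conj_inv_eq_of_clean` (`{ā⁻¹} = α`, `map_conj_inv_eq_of_esymm_eq`),
   `satake_ne_zero_of_clean` (`0 ∉ α`), `map_conj_eq_map_inv_of_clean` (`ᾱ = α⁻¹`), and the
   `w = 0` case `conj_shadow_of_clean` of the relation `{ā} = {q_v^{-w} a⁻¹}` consumed by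
   `ClozelAlgebraicityCMUnitarityProofs` (clause (iv) of Clozel's algebraicity fact).

4. `CuspidalAutomorphicRepData.exists_conj_shadow_of_W'_eq_bot` — a clean cuspidal datum
   (`W' = ⊥`, `n ≥ 1`) with ARBITRARY central behaviour: `A_G` acts on `W` by `a ↦ a^μ`
   (`exists_apply_posRealScalar_mul_eq_cpow`), the twist by `|det|^{s₀}`, `s₀ = -μ/(n[K:ℚ])`, is
   `A_G`-invariant (`ArthurClozelFibresRepData` / `AutomorphicTwistNorm` bookkeeping), and item 3
   for the twist gives `{ā} = {q_v^{r} a⁻¹}` with `r = 2 re s₀` at every unramified place ("we may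
   assume `π` unitary", Borel–Jacquet 1979, 5.7); `conj_shadow_of_apply_posRealScalar_mul_eq_cpow`
   is the same with `μ` as a datum (`r = -2 re μ / (n [K:ℚ])`).

What is not here: arbitrary cuspidal data. A datum with `W' ≠ ⊥`, or on which `A_G` does not act
semisimply (`AutomorphicRepsGLLogDetCounterexample`), carries no Petersson form, and the tree has no
theorem yet producing a clean datum with the same Satake parameters (the named fact
`cuspidal_W'_eq_bot` asserting a stable complement is refuted there); nor is the exponent `r` of
item 4 identified with the archimedean data of `π` (for a regular algebraic `π` of purity weight
`w`, `r = -w`).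

## References

* A. Deitmar, S. Echterhoff, *Principles of Harmonic Analysis*, 2nd ed. (2014), Thm. 11.2.4 and
  its proof (`T_g^* = T_{g⁻¹}` on `L²(Γ\G)^K`) [DeitmarEchterhoff2014].
* G. Shimura, *Introduction to the arithmetic theory of automorphic functions* (1971), Prop. 3.1
  and §3.4 (Hecke operators and the Petersson inner product) [Shimura1971].
* J. Arthur, L. Clozel, *Simple algebras, base change, and the advanced theory of the trace
  formula*, Annals of Math. Studies 120 (1989), Ch. 3, §2, p. 172 [ArthurClozelAMS120].
* A. Borel, H. Jacquet, *Automorphic forms and automorphic representations*, Proc. Sympos. Pure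
  Math. 33 (1979), part 1, §4.6, 5.7 [BorelJacquetCorvallis1979].
-/

noncomputable section

open scoped MatrixGroups Classical ComplexConjugate
open NumberField IsDedekindDomain
open _root_.MeasureTheory

namespace Literature.NumberTheory.Automorphic

/-! ### 1. Hecke operators and invariant Hermitian forms -/

section InvariantForm

variable {G V : Type*} [Group G] [AddCommGroup V] [Module ℂ V]

/-- A form additive and homogeneous in its first argument on a subspace `S` is additive over
finite sums of elements of `S` (the map `u ↦ B(u, w)` is `ℂ`-linear on `S`). [folklore] -/
theorem pairing_sum_left (B : V → V → ℂ) (S : Submodule ℂ V)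
    (hadd : ∀ u₁ ∈ S, ∀ u₂ ∈ S, ∀ w ∈ S, B (u₁ + u₂) w = B u₁ w + B u₂ w)
    (hsmul : ∀ (c : ℂ) (u w : V), B (c • u) w = c * B u w) {ι : Type*} (s : Finset ι)
    (f : ι → V) (hf : ∀ i, f i ∈ S) {w : V} (hw : w ∈ S) :
    B (∑ i ∈ s, f i) w = ∑ i ∈ s, B (f i) w := by
  let L : S →ₗ[ℂ] ℂ :=
    { toFun := fun u ↦ B u w
      map_add' := fun u₁ u₂ ↦ hadd _ u₁.2 _ u₂.2 w hw
      map_smul' := fun c u ↦ hsmul c u w }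
  have h1 : (∑ i ∈ s, f i) = ((∑ i ∈ s, (⟨f i, hf i⟩ : S) : S) : V) := by
    rw [Submodule.coe_sum]
  calc B (∑ i ∈ s, f i) w = L (∑ i ∈ s, ⟨f i, hf i⟩) := by rw [h1]; rfl
    _ = ∑ i ∈ s, L ⟨f i, hf i⟩ := map_sum L _ _
    _ = ∑ i ∈ s, B (f i) w := rfl

/-- **Matrix coefficients of a Hecke operator against fixed vectors, for an invariant form.**
Let `σ` be a representation of `G` on `V`, `S ≤ V` a `σ`-stable subspace and `B` a form on `V`
which on `S` is additive and homogeneous in the first variable and `σ`-invariant. For `K ≤ G`,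
`u, w ∈ S ∩ V^K` and `KgK = ⊔ᵢ yᵢ K` finite, `B([KgK] u, w) = #(KgK/K) · B(σ(g) u, w)`: each
`yᵢ = k g k'` with `k, k' ∈ K`, and `B(σ(k) σ(g) u, w) = B(σ(g) u, σ(k)⁻¹ w) = B(σ(g) u, w)`
(Shimura 1971, Prop. 3.1; Deitmar–Echterhoff 2014, proof of Thm. 11.2.4). [folklore] -/
theorem pairing_heckeOperator_apply_left (σ : Representation ℂ G V) (S : Submodule ℂ V)
    (B : V → V → ℂ) (hS : ∀ g : G, ∀ u ∈ S, σ g u ∈ S)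
    (hadd : ∀ u₁ ∈ S, ∀ u₂ ∈ S, ∀ w ∈ S, B (u₁ + u₂) w = B u₁ w + B u₂ w)
    (hsmul : ∀ (c : ℂ) (u w : V), B (c • u) w = c * B u w)
    (hinv : ∀ g : G, ∀ u ∈ S, ∀ w ∈ S, B (σ g u) (σ g w) = B u w)
    (K : Subgroup G) (g : G) (hfin : (MulAction.orbit K (g : G ⧸ K)).Finite) {u w : V}
    (huS : u ∈ S) (hwS : w ∈ S) (hu : u ∈ σ.fixedPoints K) (hw : w ∈ σ.fixedPoints K) :
    B (heckeOperator σ K g u) w = (hfin.toFinset.card : ℂ) * B (σ g u) w := by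
  classical
  rw [heckeOperator, finsum_mem_eq_finite_toFinset_sum _ hfin, LinearMap.sum_apply,
    pairing_sum_left B S hadd hsmul _ _ (fun y ↦ hS _ u huS) hwS, ← nsmul_eq_mul,
    ← Finset.sum_const]
  refine Finset.sum_congr rfl fun y hy ↦ ?_
  obtain ⟨k, hk, k', hk', H⟩ := exists_out_eq_mul_mul ((Set.Finite.mem_toFinset hfin).1 hy)
  rw [Representation.mem_fixedPoints] at hu hw
  have hk'u : σ k' u = u := hu k' hk'
  have hkw : σ k⁻¹ w = w := hw k⁻¹ (inv_mem hk)
  have e : σ k⁻¹ (σ k (σ g u)) = σ g u := by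
    change (σ k⁻¹ * σ k) (σ g u) = _
    rw [← map_mul, inv_mul_cancel, map_one]
    rfl
  change B (σ y.out u) w = _
  calc B (σ y.out u) w = B (σ k (σ g u)) w := by
        rw [H, map_mul, map_mul]
        change B (σ k (σ g (σ k' u))) w = _
        rw [hk'u]
    _ = B (σ k⁻¹ (σ k (σ g u))) (σ k⁻¹ w) := (hinv k⁻¹ _ (hS _ _ (hS _ _ huS)) _ hwS).symm
    _ = B (σ g u) w := by rw [hkw, e]

/-- **Adjoint relation between Hecke eigenvalues for an invariant Hermitian form** (the
Petersson-pairing form of `heckeEigenvalue_eq_mul_conj` of `LanglandsTetrahedralProofs`). Let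
`σ`, `S`, `B` be as in `pairing_heckeOperator_apply_left`, with `B` moreover Hermitian
(`\overline{B(u, w)} = B(w, u)`), and let `f ∈ S` be `K`-fixed with `B(f, f) ≠ 0`,
`[KxK] f = a f`, `[KyK] f = b f`, `σ(z) f = c f`, where `x⁻¹ = z⁻¹ (w y w⁻¹)` with `w ∈ K` and
the finite double cosets `KxK`, `KyK` have the same number of left cosets. Then `a = c b̄`:
`B([KgK] f, f) = #(KgK/K) B(σ(g) f, f)`, `B(σ(x) f, f) = \overline{B(σ(x⁻¹) f, f)}` and
`B(σ(x⁻¹) f, f) = c̄ B(σ(y) f, f)` by invariance (Deitmar–Echterhoff 2014, proof of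
Thm. 11.2.4 (b): `[KxK]^* ∝ [Kx⁻¹K]`; Shimura 1971, §3.4). [folklore] -/
theorem heckeEigenvalue_eq_mul_conj_of_invariantForm (σ : Representation ℂ G V)
    (S : Submodule ℂ V) (B : V → V → ℂ) (hS : ∀ g : G, ∀ u ∈ S, σ g u ∈ S)
    (hadd : ∀ u₁ ∈ S, ∀ u₂ ∈ S, ∀ w ∈ S, B (u₁ + u₂) w = B u₁ w + B u₂ w)
    (hsmul : ∀ (c : ℂ) (u w : V), B (c • u) w = c * B u w)
    (hsymm : ∀ u w : V, conj (B u w) = B w u)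
    (hinv : ∀ g : G, ∀ u ∈ S, ∀ w ∈ S, B (σ g u) (σ g w) = B u w)
    (K : Subgroup G) {x y z w : G} (hw : w ∈ K) (hxyz : x⁻¹ = z⁻¹ * (w * y * w⁻¹))
    (hx : (MulAction.orbit K (x : G ⧸ K)).Finite) (hy : (MulAction.orbit K (y : G ⧸ K)).Finite)
    (hN : hx.toFinset.card = hy.toFinset.card) {f : V} (hfS : f ∈ S)
    (hf : f ∈ σ.fixedPoints K) (hff : B f f ≠ 0) {a b c : ℂ}
    (ha : heckeOperator σ K x f = a • f) (hb : heckeOperator σ K y f = b • f)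
    (hc : σ z f = c • f) :
    a = c * conj b := by
  have hNy : (hy.toFinset.card : ℂ) ≠ 0 := by
    rw [Nat.cast_ne_zero, ← pos_iff_ne_zero, Finset.card_pos]
    exact ⟨(y : G ⧸ K), (Set.Finite.mem_toFinset _).2 (MulAction.mem_orbit_self _)⟩
  have hfix : ∀ k ∈ K, σ k f = f := fun k hk ↦ (Representation.mem_fixedPoints _ _ _).1 hf k hk
  have hcancel : ∀ (g : G) (u : V), σ g⁻¹ (σ g u) = u := fun g u ↦ by
    change (σ g⁻¹ * σ g) u = u
    rw [← map_mul, inv_mul_cancel, map_one]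
    rfl
  have hcancel' : ∀ (g : G) (u : V), σ g (σ g⁻¹ u) = u := fun g u ↦ by
    simpa only [inv_inv] using hcancel g⁻¹ u
  have hSσ : ∀ g : G, σ g f ∈ S := fun g ↦ hS g f hfS
  have hsmul_right : ∀ (d : ℂ) (u u' : V), B u (d • u') = conj d * B u u' := fun d u u' ↦ by
    rw [← hsymm (d • u') u, hsmul, map_mul, hsymm]
  have hreal : conj (B f f) = B f f := hsymm f f
  -- (1), (2): matrix coefficients of the two Hecke operators
  have h1 := pairing_heckeOperator_apply_left σ S B hS hadd hsmul hinv K x hx hfS hfS hf hf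
  rw [ha, hsmul, hN] at h1
  have h2 := pairing_heckeOperator_apply_left σ S B hS hadd hsmul hinv K y hy hfS hfS hf hf
  rw [hb, hsmul] at h2
  have h2' : B (σ y f) f = b * B f f / hy.toFinset.card := by
    rw [eq_div_iff hNy, mul_comm]
    exact h2.symm
  -- (3): `B(σ x⁻¹ f, f) = c̄ B(σ y f, f)`
  have h3 : B (σ x⁻¹ f) f = conj c * B (σ y f) f := by
    have e1 : σ x⁻¹ f = σ z⁻¹ (σ w (σ y f)) := by
      rw [hxyz, map_mul, map_mul, map_mul]
      change σ z⁻¹ (σ w (σ y (σ w⁻¹ f))) = _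
      rw [hfix w⁻¹ (inv_mem hw)]
    calc B (σ x⁻¹ f) f = B (σ z (σ z⁻¹ (σ w (σ y f)))) (σ z f) := by
          rw [e1]
          exact (hinv z _ (hS _ _ (hS _ _ (hSσ y))) _ hfS).symm
      _ = conj c * B (σ w (σ y f)) f := by rw [hcancel', hc, hsmul_right]
      _ = conj c * B (σ w⁻¹ (σ w (σ y f))) (σ w⁻¹ f) := by
          rw [hinv w⁻¹ _ (hS _ _ (hSσ y)) _ hfS]
      _ = conj c * B (σ y f) f := by rw [hcancel, hfix w⁻¹ (inv_mem hw)]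
  -- (4): `B(σ x f, f) = conj B(σ x⁻¹ f, f)`
  have h4 : B (σ x f) f = conj (B (σ x⁻¹ f) f) := by
    rw [hsymm]
    calc B (σ x f) f = B (σ x⁻¹ (σ x f)) (σ x⁻¹ f) := (hinv x⁻¹ _ (hSσ x) _ hfS).symm
      _ = B f (σ x⁻¹ f) := by rw [hcancel]
  have hNc : conj (hy.toFinset.card : ℂ) = hy.toFinset.card := map_natCast _ _
  have key : a * B f f = c * conj b * B f f := by
    calc a * B f f = (hy.toFinset.card : ℂ) * B (σ x f) f := h1
      _ = (hy.toFinset.card : ℂ) * conj (conj c * (b * B f f / hy.toFinset.card)) := by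
          rw [h4, h3, h2']
      _ = c * conj b * B f f := by
          rw [map_mul, map_div₀, map_mul, Complex.conj_conj, hreal, hNc]
          field_simp
  exact mul_right_cancel₀ hff key

/-- **Eigenvalues of invariant operators have absolute value one.** If `σ(z) f = c f` with
`f ∈ S`, `B(f, f) ≠ 0`, for a form `B` homogeneous in the first variable, Hermitian and
`σ`-invariant on `S`, then `|c| = 1` (`B(f, f) = B(c f, c f) = c c̄ B(f, f)`). For the Petersson
pairing and the central Hecke element `t_{v,n}` this is the unitarity of the central character of
an `A_G`-invariant cusp form (Borel–Jacquet 1979, 5.7). [folklore] -/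
theorem norm_eq_one_of_invariantForm (σ : Representation ℂ G V) (S : Submodule ℂ V)
    (B : V → V → ℂ) (hsmul : ∀ (c : ℂ) (u w : V), B (c • u) w = c * B u w)
    (hsymm : ∀ u w : V, conj (B u w) = B w u)
    (hinv : ∀ g : G, ∀ u ∈ S, ∀ w ∈ S, B (σ g u) (σ g w) = B u w) {z : G} {f : V}
    (hfS : f ∈ S) (hff : B f f ≠ 0) {c : ℂ} (hc : σ z f = c • f) : ‖c‖ = 1 := by
  have hsmul_right : ∀ (d : ℂ) (u u' : V), B u (d • u') = conj d * B u u' := fun d u u' ↦ by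
    rw [← hsymm (d • u') u, hsmul, map_mul, hsymm]
  have h := hinv z f hfS f hfS
  rw [hc, hsmul, hsmul_right, ← mul_assoc] at h
  have h1 : c * conj c = 1 := mul_right_cancel₀ hff (h.trans (one_mul _).symm)
  rw [Complex.mul_conj] at h1
  have h2 : Complex.normSq c = 1 := by exact_mod_cast h1
  have h3 : ‖c‖ ^ 2 = 1 ^ 2 := by rw [← Complex.normSq_eq_norm_sq, h2, one_pow]
  exact (pow_left_inj₀ (norm_nonneg c) zero_le_one two_ne_zero).1 h3

end InvariantForm

/-! ### 2. Unitarity of the unramified components of `A_G`-invariant clean cuspidal data -/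

section Clean

variable {n : ℕ} {K : Type} [Field K] [NumberField K] {hcpt : isCompact_glFiniteIntegralLevel n K}

/-- **The adjoint relations `e_i(α) = e_n(α) \overline{e_{n-i}(α)}` and `|e_n(α)| = 1` for the
Satake parameters of an `A_G`-invariant clean cuspidal Borel–Jacquet datum.** Let `π = W / ⊥` be
cuspidal on `GL_n(𝔸_K)` with all forms invariant under `A_G`, and `π.HasSatakeParamAt v α`. The
`K(𝔫)`-fixed form `φ ∈ W`, `φ ≠ 0`, of the definition is an eigenvector of `[K(𝔫) t_{v,i} K(𝔫)]`
with eigenvalue `q_v^{i(n-i)/2} e_i(α)` (no `W'` to reduce modulo); by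
`heckeOperator_sphericalLevelAt_eq_principalCongruenceLevel` and `heckeOperator_map_apply_eq` these
are eigen-equations for the local operators `[K₀ t_i K₀]`, `K₀ = GL_n(𝒪_v)`, of the restriction
`σ` of right translation to `GL_n(K_v) ↪ GL_n(𝔸_K)`; the Petersson pairing `⟪·, ·⟫_μ`
(`AdelicGroupData.l2Pairing` for an automorphic measure `μ`,
`exists_isAutomorphicMeasure_gl_holds`) is a `σ`-invariant positive-definite Hermitian form on
`bddInvariant ⊇ W` (`cuspidal_bounded_holds`, `le_bddInvariant_of_cuspidal_bounded`); `t_n` is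
central and acts by `e_n(α)`; and `t_i⁻¹ = t_n⁻¹ (w t_{n-i} w⁻¹)` with `w ∈ K₀` a permutation,
`#(K₀ t_i K₀/K₀) = #(K₀ t_{n-i} K₀/K₀)` (`exists_perm_conj_heckeDiag`, `ncard_orbit_eq_of_inv_eq`).
So `heckeEigenvalue_eq_mul_conj_of_invariantForm` and `norm_eq_one_of_invariantForm` apply: the
classical `T_i^* = T_n⁻¹ T_{n-i}` for the Petersson inner product (Deitmar–Echterhoff 2014,
Thm. 11.2.4; Shimura 1971, §3.4; Arthur–Clozel 1989, Ch. 3, p. 172).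
[cite: DeitmarEchterhoff2014, Thm. 11.2.4] -/
theorem CuspidalAutomorphicRepData.esymm_eq_mul_conj_esymm_of_clean
    (π : CuspidalAutomorphicRepData n K hcpt) (hW' : π.1.W' = ⊥)
    (hAG : ∀ φ ∈ π.1.W, ∀ z ∈ (AdelicGroupData.gl n K).center', ∀ g, φ (z * g) = φ g)
    {v : HeightOneSpectrum (𝓞 K)} {α : Multiset ℂ} (h : π.1.HasSatakeParamAt v α) :
    (∀ i ≤ n, α.esymm i = α.esymm n * conj (α.esymm (n - i))) ∧ ‖α.esymm n‖ = 1 := by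
  classical
  obtain ⟨𝔫, ϖ, h𝔫, hv𝔫, -, -, φ, hφW, hφW', hfix, hT⟩ := h
  -- the automorphic measure and the Petersson pairing on bounded invariant functions
  obtain ⟨μ, hμ⟩ := AdelicGroupData.exists_isAutomorphicMeasure_gl_holds n K
  have hWS : π.1.W ≤ (AdelicGroupData.gl n K).bddInvariant :=
    AutomorphicRepsGL.le_bddInvariant_of_cuspidal_bounded
      (AutomorphicRepsGL.cuspidal_bounded_holds (hcpt := hcpt)) π.2 hAG
  set S : Submodule ℂ ((AdelicGroupData.gl n K).Adelic → ℂ) := (AdelicGroupData.gl n K).bddInvariant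
    with hS_def
  set B : ((AdelicGroupData.gl n K).Adelic → ℂ) → ((AdelicGroupData.gl n K).Adelic → ℂ) → ℂ :=
    (AdelicGroupData.gl n K).l2Pairing μ with hB_def
  set ρ : Representation ℂ (AdelicGroupData.gl n K).Adelic ((AdelicGroupData.gl n K).Adelic → ℂ) :=
    rightTranslation (AdelicGroupData.gl n K) with hρ
  set ι : GL (Fin n) (v.adicCompletion K) →* GL (Fin n) (AdeleRing (𝓞 K) K) := GLn.ofLocal n K v
    with hι
  set K₀ : Subgroup (GL (Fin n) (v.adicCompletion K)) :=
    valuedCongruenceSubgroup (Fin n) (1 : WithZero (Multiplicative ℤ)) with hK₀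
  let σ : Representation ℂ (GL (Fin n) (v.adicCompletion K))
      ((AdelicGroupData.gl n K).Adelic → ℂ) := ρ.comp ι
  -- the hypotheses of Section 1 for `σ`, `S = bddInvariant`, `B = ⟪·, ·⟫_μ`
  have hSstab : ∀ g, ∀ u ∈ S, σ g u ∈ S := fun g u hu ↦
    AdelicGroupData.rightTranslation_mem_bddInvariant hu (ι g)
  have hadd : ∀ u₁ ∈ S, ∀ u₂ ∈ S, ∀ w ∈ S, B (u₁ + u₂) w = B u₁ w + B u₂ w :=
    fun u₁ h₁ u₂ h₂ w hw ↦ AdelicGroupData.l2Pairing_add_left h₁ h₂ hw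
  have hsmul : ∀ (c : ℂ) (u w : (AdelicGroupData.gl n K).Adelic → ℂ), B (c • u) w = c * B u w :=
    fun c u w ↦ AdelicGroupData.l2Pairing_smul_left c u w
  have hsymm : ∀ u w : (AdelicGroupData.gl n K).Adelic → ℂ, conj (B u w) = B w u :=
    fun u w ↦ AdelicGroupData.l2Pairing_conj_symm u w
  have hinv : ∀ g, ∀ u ∈ S, ∀ w ∈ S, B (σ g u) (σ g w) = B u w := fun g u hu w hw ↦
    AdelicGroupData.l2Pairing_rightTranslation (AdelicGroupData.mem_bddInvariant_iff.1 hu).2.2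
      (AdelicGroupData.mem_bddInvariant_iff.1 hw).2.2 (ι g)
  -- the eigenform `φ`: non-zero, in `S`, with `⟪φ, φ⟫ ≠ 0`, fixed by `K(𝔫) ⊇ GL_n(𝒪_v)`
  have hφ0 : φ ≠ 0 := fun h0 ↦ hφW' (by rw [h0]; exact Submodule.zero_mem _)
  have hφS : φ ∈ S := hWS hφW
  have hff : B φ φ ≠ 0 := fun h0 ↦
    hφ0 (AdelicGroupData.eq_zero_of_l2Pairing_self_eq_zero hφS h0)
  have hfP : φ ∈ ρ.fixedPoints (principalCongruenceLevel n K 𝔫) :=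
    (Representation.mem_fixedPoints _ _ _).2 hfix
  have hle : Literature.NumberTheory.Automorphic.sphericalLevelAt K n v ≤
      principalCongruenceLevel n K 𝔫 :=
    isMaximalAt_principalCongruenceLevel n K v h𝔫 hv𝔫
  have hfP₀ : φ ∈ ρ.fixedPoints (K₀.map ι) := ρ.fixedPoints_antitone hle hfP
  have hfσ : φ ∈ Representation.fixedPoints σ K₀ :=
    (Representation.mem_fixedPoints _ _ _).2 fun k hk ↦
      (Representation.mem_fixedPoints _ _ _).1 hfP₀ (ι k) ⟨k, hk, rfl⟩
  have hfin₀ : ∀ g : GL (Fin n) (v.adicCompletion K),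
      (MulAction.orbit K₀ (g : GL (Fin n) (v.adicCompletion K) ⧸ K₀)).Finite :=
    finite_orbit_valuedCongruenceSubgroup_one n K v
  -- genuine eigen-equations (`W' = ⊥`), read on `GL_n(K_v)` at the spherical level
  have hT' : ∀ j ≤ n, heckeOperator ρ (principalCongruenceLevel n K 𝔫) (heckeDiagAt n K v ϖ j) φ =
      ((((Real.sqrt (v.residueCard : ℝ)) : ℝ) : ℂ) ^ (j * (n - j)) * α.esymm j) • φ := by
    intro j hj
    have e := hT j hj
    rw [hW', Submodule.mem_bot, sub_eq_zero] at e
    exact e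
  have heig : ∀ j ≤ n, heckeOperator σ K₀ (heckeDiag n ϖ j) φ =
      ((((Real.sqrt (v.residueCard : ℝ)) : ℝ) : ℂ) ^ (j * (n - j)) * α.esymm j) • φ := by
    intro j hj
    -- `[K₀ t_j K₀]` on `GL_n(K_v)` = `[GL_n(𝒪_v) t_{v,j} GL_n(𝒪_v)]` = `[K(𝔫) t_{v,j} K(𝔫)]` on `φ`
    have e1 : heckeOperator σ K₀ (heckeDiag n ϖ j) φ =
        heckeOperator ρ (K₀.map ι) (ι (heckeDiag n ϖ j)) φ :=
      (heckeOperator_map_apply_eq ι GLn.ofLocal_injective K₀ ρ (heckeDiag n ϖ j) (hfin₀ _)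
        hfP₀).symm
    have e2 : heckeOperator ρ (K₀.map ι) (ι (heckeDiag n ϖ j)) φ =
        heckeOperator ρ (principalCongruenceLevel n K 𝔫) (GLn.ofLocal n K v (heckeDiag n ϖ j)) φ :=
      heckeOperator_sphericalLevelAt_eq_principalCongruenceLevel ρ h𝔫 hv𝔫 (heckeDiag n ϖ j) hfP
    have e3 := congrArg (fun x ↦ heckeOperator ρ (principalCongruenceLevel n K 𝔫) x φ)
      (heckeDiagAt_eq_ofLocal (n := n) (K := K) (v := v) ϖ j)
    exact e1.trans (e2.trans (e3.symm.trans (hT' j hj)))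
  -- the central element `t_n` acts by `e_n(α)`
  have hz : σ (heckeDiag n ϖ n) φ = α.esymm n • φ := by
    have e := heckeOperator_apply_of_mem_center ρ (principalCongruenceLevel n K 𝔫)
      (heckeDiagAt_self_mem_center v ϖ) hfP
    rw [hT' n le_rfl, Nat.sub_self, mul_zero, pow_zero, one_mul, heckeDiagAt_eq_ofLocal] at e
    exact e.symm
  have hnorm : ‖α.esymm n‖ = 1 := norm_eq_one_of_invariantForm σ S B hsmul hsymm hinv hφS hff hz
  refine ⟨fun i hi ↦ ?_, hnorm⟩
  -- the permutation `w` and the relation `t_i⁻¹ = t_n⁻¹ (w t_{n-i} w⁻¹)`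
  obtain ⟨w, hw01, hww, hwD⟩ := exists_perm_conj_heckeDiag (v.adicCompletion K) n ϖ hi
  have hwinv : w⁻¹ = w := inv_eq_of_mul_eq_one_right hww
  have hwK : w ∈ K₀ := mem_valuedCongruenceSubgroup_one_of_entries hw01 hwinv
  have hxyz : (heckeDiag n ϖ i)⁻¹ = (heckeDiag n ϖ n)⁻¹ * (w * heckeDiag n ϖ (n - i) * w⁻¹) := by
    refine inv_eq_of_mul_eq_one_left ?_
    rw [mul_assoc, hwD, inv_mul_cancel]
  -- equal degrees
  have hN : (hfin₀ (heckeDiag n ϖ i)).toFinset.card =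
      (hfin₀ (heckeDiag n ϖ (n - i))).toFinset.card := by
    rw [← Set.ncard_eq_toFinset_card _ (hfin₀ _), ← Set.ncard_eq_toFinset_card _ (hfin₀ _)]
    exact ncard_orbit_eq_of_inv_eq (heckeDiag_self_mem_center ϖ) hwK hxyz
  have key := heckeEigenvalue_eq_mul_conj_of_invariantForm σ S B hSstab hadd hsmul hsymm hinv K₀
    hwK hxyz (hfin₀ _) (hfin₀ _) hN hφS hfσ hff (heig i hi) (heig (n - i) (Nat.sub_le n i)) hz
  rw [Nat.sub_sub_self hi, map_mul, map_pow, Complex.conj_ofReal, Nat.mul_comm (n - i) i] at key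
  have hq0 : ((((Real.sqrt (v.residueCard : ℝ)) : ℝ) : ℂ)) ^ (i * (n - i)) ≠ 0 :=
    pow_ne_zero _ (sqrt_residueCard_ne_zero v)
  refine mul_left_cancel₀ hq0 (key.trans ?_)
  ring

/-- **Unramified components of `A_G`-invariant clean cuspidal data are unitary, Satake shadow**:
the Satake parameter `α` of such a `π` at `v` is stable under `a ↦ ā⁻¹`, `{ā⁻¹ : a ∈ α} = α`
(`map_conj_inv_eq_of_esymm_eq` from the adjoint relations) — `\bar t_{π,v} = t_{π,v}⁻¹` as
conjugacy classes, i.e. the Hecke matrix of the complex conjugate is that of the contragredient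
(Arthur–Clozel 1989, Ch. 3, p. 172; Jacquet–Shalika 1981 I, §2). The `L²` counterpart is
`HasSatakeParameterAt.map_conj_inv_eq`. [cite: ArthurClozelAMS120, Ch. 3, §2 (p. 172)] -/
theorem CuspidalAutomorphicRepData.map_conj_inv_eq_of_clean
    (π : CuspidalAutomorphicRepData n K hcpt) (hW' : π.1.W' = ⊥)
    (hAG : ∀ φ ∈ π.1.W, ∀ z ∈ (AdelicGroupData.gl n K).center', ∀ g, φ (z * g) = φ g)
    {v : HeightOneSpectrum (𝓞 K)} {α : Multiset ℂ} (h : π.1.HasSatakeParamAt v α) :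
    α.map (fun a ↦ (conj a)⁻¹) = α := by
  obtain ⟨he, hnorm⟩ := π.esymm_eq_mul_conj_esymm_of_clean hW' hAG h
  exact map_conj_inv_eq_of_esymm_eq h.card_eq hnorm he

/-- The Satake parameters of an `A_G`-invariant clean cuspidal datum are **non-zero**
(`|e_n(α)| = |∏ α| = 1`). [folklore] -/
theorem CuspidalAutomorphicRepData.satake_ne_zero_of_clean
    (π : CuspidalAutomorphicRepData n K hcpt) (hW' : π.1.W' = ⊥)
    (hAG : ∀ φ ∈ π.1.W, ∀ z ∈ (AdelicGroupData.gl n K).center', ∀ g, φ (z * g) = φ g)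
    {v : HeightOneSpectrum (𝓞 K)} {α : Multiset ℂ} (h : π.1.HasSatakeParamAt v α) :
    ∀ a ∈ α, a ≠ 0 := by
  obtain ⟨-, hnorm⟩ := π.esymm_eq_mul_conj_esymm_of_clean hW' hAG h
  have hprod : α.esymm n = α.prod := by
    rw [← h.card_eq, Multiset.esymm, Multiset.powersetCard_self, Multiset.map_singleton,
      Multiset.sum_singleton]
  intro a ha h0
  have hz : α.prod = 0 := Multiset.prod_eq_zero (h0 ▸ ha)
  rw [hprod, hz, norm_zero] at hnorm
  exact zero_ne_one hnorm

/-- Equivalently **`ᾱ = α⁻¹` as multisets**: `{ā : a ∈ α} = {a⁻¹ : a ∈ α}`. [cite: ArthurClozelAMS120, Ch. 3, §2 (p. 172)] -/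
theorem CuspidalAutomorphicRepData.map_conj_eq_map_inv_of_clean
    (π : CuspidalAutomorphicRepData n K hcpt) (hW' : π.1.W' = ⊥)
    (hAG : ∀ φ ∈ π.1.W, ∀ z ∈ (AdelicGroupData.gl n K).center', ∀ g, φ (z * g) = φ g)
    {v : HeightOneSpectrum (𝓞 K)} {α : Multiset ℂ} (h : π.1.HasSatakeParamAt v α) :
    α.map conj = α.map (·⁻¹) := by
  have hα := π.map_conj_inv_eq_of_clean hW' hAG h
  calc α.map conj = (α.map (fun a ↦ (conj a)⁻¹)).map (·⁻¹) := by
        rw [Multiset.map_map]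
        exact Multiset.map_congr rfl fun a _ ↦ by simp
    _ = α.map (·⁻¹) := by rw [hα]

/-- The same in the shape `{ā} = {q_v^{-w} a⁻¹}` with `w = 0` (and `0 ∉ α`) consumed by the
reduction of clause (iv) of Clozel's algebraicity fact
(`isTotallyReal_or_isCMField_ratField_of_conj_shadow` of `ClozelAlgebraicityCMUnitarityProofs`):
for an `A_G`-invariant clean cuspidal datum the relation holds at EVERY unramified place.
[cite: ArthurClozelAMS120, Ch. 3, §2 (p. 172)] -/
theorem CuspidalAutomorphicRepData.conj_shadow_of_clean
    (π : CuspidalAutomorphicRepData n K hcpt) (hW' : π.1.W' = ⊥)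
    (hAG : ∀ φ ∈ π.1.W, ∀ z ∈ (AdelicGroupData.gl n K).center', ∀ g, φ (z * g) = φ g)
    {v : HeightOneSpectrum (𝓞 K)} {α : Multiset ℂ} (h : π.1.HasSatakeParamAt v α) :
    (∀ a ∈ α, a ≠ 0) ∧ α.map conj = α.map (fun a ↦ (v.residueCard : ℂ) ^ (-(0 : ℤ)) * a⁻¹) := by
  refine ⟨π.satake_ne_zero_of_clean hW' hAG h, ?_⟩
  rw [π.map_conj_eq_map_inv_of_clean hW' hAG h]
  exact Multiset.map_congr rfl fun a _ ↦ by simp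

end Clean

/-! ### 3. Clean cuspidal data with arbitrary central behaviour: `{ā} = {q_v^{r} a⁻¹}` -/

section Twist

open Literature.NumberTheory.GaloisRepresentations (HeckeCharacter ideleGroup)

variable {n : ℕ} {K : Type} [Field K] [NumberField K] {hcpt : isCompact_glFiniteIntegralLevel n K}

/-- **"We may assume `π` unitary", Satake shadow, for clean cuspidal data.** Let `π = W / ⊥` be a
cuspidal Borel–Jacquet datum on `GL_n(𝔸_K)`, `n ≥ 1`. Then there is a real number `r` such that
at EVERY unramified place the Satake parameter `α` of `π` satisfies `0 ∉ α` and
`{ā : a ∈ α} = {q_v^{r} a⁻¹ : a ∈ α}`. Proof (Borel–Jacquet 1979, 5.7; Arthur–Clozel 1989, Ch. 3,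
proof of Thm. 3.1): `A_G` acts on `W` by `a ↦ a^μ` (`exists_apply_posRealScalar_mul_eq_cpow`);
the twist `π₁ = π ⊗ |det|^{s₀}`, `s₀ = -μ / (n [K:ℚ])`, is a clean cuspidal datum with
`A_G`-invariant forms (`exists_cuspidalAutomorphicRepData_map_mulChar_detTwist`,
`mulChar_detTwist_apply_posRealScalar_mul_of_cpow`) and Satake parameters `c α`, `c = q_v^{-s₀}`
(`HasSatakeParamAt.of_map_mulChar_detTwist_of_cpow`); by `map_conj_eq_map_inv_of_clean`,
`{c̄ ā} = {c⁻¹ a⁻¹}`, i.e. `{ā} = {(c c̄)⁻¹ a⁻¹}` with `(c c̄)⁻¹ = |c|⁻² = q_v^{2 re s₀}`; so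
`r = 2 re s₀ = -2 re μ / (n [K:ℚ])`. For a regular algebraic `π` of purity weight `w` one expects
`r = -w` (the archimedean central character, not computed here). [cite: BorelJacquetCorvallis1979, 5.7] -/
theorem CuspidalAutomorphicRepData.exists_conj_shadow_of_W'_eq_bot [NeZero n]
    (π : CuspidalAutomorphicRepData n K hcpt) (hW' : π.1.W' = ⊥) :
    ∃ r : ℝ, ∀ (v : HeightOneSpectrum (𝓞 K)) (α : Multiset ℂ), π.1.HasSatakeParamAt v α →
      (∀ a ∈ α, a ≠ 0) ∧
        α.map conj = α.map (fun a ↦ (((v.residueCard : ℝ) ^ r : ℝ) : ℂ) * a⁻¹) := by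
  -- the `A_G`-exponent `μ`, the normalising exponent `s₀` and the character `|·|^{s₀}`
  obtain ⟨μ, hμ⟩ := π.1.exists_apply_posRealScalar_mul_eq_cpow hW'
  have hnd : ((n * Module.finrank ℚ K : ℕ) : ℂ) ≠ 0 := by
    exact_mod_cast (Nat.mul_ne_zero (NeZero.ne n) Module.finrank_pos.ne')
  set s₀ : ℂ := -μ / (n * Module.finrank ℚ K : ℕ) with hs₀
  have hs : s₀ * (n * Module.finrank ℚ K : ℕ) = -μ := by rw [hs₀, div_mul_cancel₀ _ hnd]
  obtain ⟨χ, hχ⟩ := exists_heckeCharacter_ideleNorm_cpow K s₀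
  -- the twisted datum `π₁ = π ⊗ |det|^{s₀}`: clean, with `A_G`-invariant forms
  obtain ⟨π₁, h1W, h1W'⟩ := exists_cuspidalAutomorphicRepData_map_mulChar_detTwist hχ π
  have h1W'bot : π₁.1.W' = ⊥ := by rw [h1W', hW', Submodule.map_bot]
  have hAG : ∀ φ ∈ π₁.1.W, ∀ z ∈ (AdelicGroupData.gl n K).center', ∀ g, φ (z * g) = φ g := by
    intro φ hφ z hz g
    rw [h1W] at hφ
    obtain ⟨φ₀, hφ₀, rfl⟩ := hφ
    obtain ⟨t, rfl⟩ := hz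
    exact mulChar_detTwist_apply_posRealScalar_mul_of_cpow hχ hs (hμ φ₀ hφ₀) t g
  refine ⟨2 * s₀.re, fun v α hα ↦ ?_⟩
  have hq : (0 : ℝ) < (v.residueCard : ℝ) := by
    exact_mod_cast Nat.zero_lt_of_lt v.one_lt_residueCard
  have hq' : (v.residueCard : ℂ) ≠ 0 := by
    exact_mod_cast (Nat.zero_lt_of_lt v.one_lt_residueCard).ne'
  set c : ℂ := (v.residueCard : ℂ) ^ (-s₀) with hc
  have hc0 : c ≠ 0 := fun h0 ↦ hq' ((Complex.cpow_eq_zero_iff _ _).1 h0).1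
  have hcc : conj c ≠ 0 := (map_ne_zero _).2 hc0
  -- `c c̄ = |c|² = q_v^{-2 re s₀}`
  have h2 : c * conj c = (((v.residueCard : ℝ) ^ (-(2 * s₀.re)) : ℝ) : ℂ) := by
    rw [Complex.mul_conj, Complex.normSq_eq_norm_sq]
    congr 1
    rw [hc, ← Complex.ofReal_natCast, Complex.norm_cpow_eq_rpow_re_of_pos hq, Complex.neg_re,
      ← Real.rpow_natCast, ← Real.rpow_mul hq.le]
    congr 1
    push_cast
    ring
  -- the Satake parameter `c α` of the twist, and its unitarity
  have h1 : π₁.1.HasSatakeParamAt v (α.map (c * ·)) :=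
    AutomorphicRepData.HasSatakeParamAt.of_map_mulChar_detTwist_of_cpow hχ h1W h1W' hα
  have hne := π₁.satake_ne_zero_of_clean h1W'bot hAG h1
  have hconj := π₁.map_conj_eq_map_inv_of_clean h1W'bot hAG h1
  refine ⟨fun a ha h0 ↦ hne (c * a) (Multiset.mem_map_of_mem _ ha) (by rw [h0, mul_zero]), ?_⟩
  -- strip the constant `c̄` on the left
  have key := congrArg (Multiset.map (fun x ↦ (conj c)⁻¹ * x)) hconj
  simp only [Multiset.map_map, Function.comp_def, map_mul] at key
  have lhs : α.map (fun a ↦ (conj c)⁻¹ * (conj c * conj a)) = α.map conj :=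
    Multiset.map_congr rfl fun a _ ↦ by rw [← mul_assoc, inv_mul_cancel₀ hcc, one_mul]
  have rhs : α.map (fun a ↦ (conj c)⁻¹ * (c * a)⁻¹) =
      α.map (fun a ↦ (((v.residueCard : ℝ) ^ (2 * s₀.re) : ℝ) : ℂ) * a⁻¹) :=
    Multiset.map_congr rfl fun a _ ↦ by
      calc (conj c)⁻¹ * (c * a)⁻¹ = (c * conj c)⁻¹ * a⁻¹ := by rw [mul_inv, mul_inv]; ring
        _ = (((v.residueCard : ℝ) ^ (2 * s₀.re) : ℝ) : ℂ) * a⁻¹ := by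
          rw [h2, ← Complex.ofReal_inv, Real.rpow_neg hq.le, inv_inv]
  rw [lhs, rhs] at key
  exact key

open scoped NNReal in
/-- **The same with the `A_G`-exponent made explicit.** If `π = W / ⊥` is cuspidal (`n ≥ 1`) and
`A_G` acts on `W` by `a ↦ a^μ` (`φ (a g) = a^μ φ (g)`; such a `μ` always exists,
`exists_apply_posRealScalar_mul_eq_cpow`), then at every unramified place the Satake parameter
`α` of `π` satisfies `0 ∉ α` and `{ā : a ∈ α} = {q_v^{r} a⁻¹ : a ∈ α}` with
`r = -2 re μ / (n [K:ℚ])` (`= 2 re s₀` for the normalising exponent `s₀ = -μ/(n[K:ℚ])` of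
`π ⊗ |det|^{s₀}`). For a regular algebraic `π` whose infinity type is pure of weight `w` one has
`μ = n [K:ℚ] w / 2` (the split centre acts through the archimedean central character), whence
`r = -w`. (Borel–Jacquet 1979, 5.7.) [cite: BorelJacquetCorvallis1979, 5.7] -/
theorem CuspidalAutomorphicRepData.conj_shadow_of_apply_posRealScalar_mul_eq_cpow [NeZero n]
    (π : CuspidalAutomorphicRepData n K hcpt) (hW' : π.1.W' = ⊥) {μ : ℂ}
    (hμ : ∀ φ ∈ π.1.W, ∀ (t : ℝ≥0ˣ) (g : (AdelicGroupData.gl n K).Adelic),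
      φ ((show (AdelicGroupData.gl n K).Adelic from posRealScalar n K t) * g) =
        (((t : ℝ≥0) : ℝ) : ℂ) ^ μ * φ g)
    {v : HeightOneSpectrum (𝓞 K)} {α : Multiset ℂ} (hα : π.1.HasSatakeParamAt v α) :
    (∀ a ∈ α, a ≠ 0) ∧
      α.map conj = α.map (fun a ↦
        (((v.residueCard : ℝ) ^ (-(2 * μ.re) / (n * Module.finrank ℚ K : ℕ)) : ℝ) : ℂ) * a⁻¹) := by
  -- the normalising exponent `s₀` and the character `|·|^{s₀}`
  have hnd : ((n * Module.finrank ℚ K : ℕ) : ℂ) ≠ 0 := by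
    exact_mod_cast (Nat.mul_ne_zero (NeZero.ne n) Module.finrank_pos.ne')
  set s₀ : ℂ := -μ / (n * Module.finrank ℚ K : ℕ) with hs₀
  have hs : s₀ * (n * Module.finrank ℚ K : ℕ) = -μ := by rw [hs₀, div_mul_cancel₀ _ hnd]
  have hre : 2 * s₀.re = -(2 * μ.re) / (n * Module.finrank ℚ K : ℕ) := by
    rw [hs₀, ← Complex.ofReal_natCast, Complex.div_ofReal_re, Complex.neg_re]
    ring
  obtain ⟨χ, hχ⟩ := exists_heckeCharacter_ideleNorm_cpow K s₀
  -- the twisted datum `π₁ = π ⊗ |det|^{s₀}`: clean, with `A_G`-invariant forms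
  obtain ⟨π₁, h1W, h1W'⟩ := exists_cuspidalAutomorphicRepData_map_mulChar_detTwist hχ π
  have h1W'bot : π₁.1.W' = ⊥ := by rw [h1W', hW', Submodule.map_bot]
  have hAG : ∀ φ ∈ π₁.1.W, ∀ z ∈ (AdelicGroupData.gl n K).center', ∀ g, φ (z * g) = φ g := by
    intro φ hφ z hz g
    rw [h1W] at hφ
    obtain ⟨φ₀, hφ₀, rfl⟩ := hφ
    obtain ⟨t, rfl⟩ := hz
    exact mulChar_detTwist_apply_posRealScalar_mul_of_cpow hχ hs (hμ φ₀ hφ₀) t g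
  have hq : (0 : ℝ) < (v.residueCard : ℝ) := by
    exact_mod_cast Nat.zero_lt_of_lt v.one_lt_residueCard
  have hq' : (v.residueCard : ℂ) ≠ 0 := by
    exact_mod_cast (Nat.zero_lt_of_lt v.one_lt_residueCard).ne'
  set c : ℂ := (v.residueCard : ℂ) ^ (-s₀) with hc
  have hc0 : c ≠ 0 := fun h0 ↦ hq' ((Complex.cpow_eq_zero_iff _ _).1 h0).1
  have hcc : conj c ≠ 0 := (map_ne_zero _).2 hc0
  -- `c c̄ = |c|² = q_v^{-2 re s₀}`
  have h2 : c * conj c = (((v.residueCard : ℝ) ^ (-(2 * s₀.re)) : ℝ) : ℂ) := by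
    rw [Complex.mul_conj, Complex.normSq_eq_norm_sq]
    congr 1
    rw [hc, ← Complex.ofReal_natCast, Complex.norm_cpow_eq_rpow_re_of_pos hq, Complex.neg_re,
      ← Real.rpow_natCast, ← Real.rpow_mul hq.le]
    congr 1
    push_cast
    ring
  -- the Satake parameter `c α` of the twist, and its unitarity
  have h1 : π₁.1.HasSatakeParamAt v (α.map (c * ·)) :=
    AutomorphicRepData.HasSatakeParamAt.of_map_mulChar_detTwist_of_cpow hχ h1W h1W' hα
  have hne := π₁.satake_ne_zero_of_clean h1W'bot hAG h1
  have hconj := π₁.map_conj_eq_map_inv_of_clean h1W'bot hAG h1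
  refine ⟨fun a ha h0 ↦ hne (c * a) (Multiset.mem_map_of_mem _ ha) (by rw [h0, mul_zero]), ?_⟩
  -- strip the constant `c̄` on the left
  have key := congrArg (Multiset.map (fun x ↦ (conj c)⁻¹ * x)) hconj
  simp only [Multiset.map_map, Function.comp_def, map_mul] at key
  have lhs : α.map (fun a ↦ (conj c)⁻¹ * (conj c * conj a)) = α.map conj :=
    Multiset.map_congr rfl fun a _ ↦ by rw [← mul_assoc, inv_mul_cancel₀ hcc, one_mul]
  have rhs : α.map (fun a ↦ (conj c)⁻¹ * (c * a)⁻¹) =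
      α.map (fun a ↦ (((v.residueCard : ℝ) ^ (2 * s₀.re) : ℝ) : ℂ) * a⁻¹) :=
    Multiset.map_congr rfl fun a _ ↦ by
      calc (conj c)⁻¹ * (c * a)⁻¹ = (c * conj c)⁻¹ * a⁻¹ := by rw [mul_inv, mul_inv]; ring
        _ = (((v.residueCard : ℝ) ^ (2 * s₀.re) : ℝ) : ℂ) * a⁻¹ := by
          rw [h2, ← Complex.ofReal_inv, Real.rpow_neg hq.le, inv_inv]
  rw [lhs, rhs, hre] at key
  exact key

end Twist

end Literature.NumberTheory.Automorphic
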